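import Summits.CriticalPhenomena.PercolationContinuityZ3.Theorems.Transplant.Slab111HubEntry2
import Summits.CriticalPhenomena.PercolationContinuityZ3.Theorems.Transplant.Slab111HubCheck
import HarnessLib

/-!
# The HUB ROUTING of the `(111)`-films, XVI: Boolean checkers for the table language v3 (`Entry.ok2`, pair validity, boundary acceptance)

builds on p205010 (kernel theorem, internal audit signed; external expert review pending) — NOT used in this file.  Lane `prim-bschramm`, seat
`prim-bschramm-p2` (gen 36; class C1b; memo `HOME/bschramm/P2-LATTICES.md` §130); helper file (`--supports stmt-CriticalPhenomena-4575 --as helper`).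
Kernel-evaluable (`decide +kernel`) Boolean forms, with soundness, of: §1 `LegFits2` / the bit-free part of «Slab111HubEntry2».`Entry.ok2`
(`Entry.baseB`, region membership by a Boolean PREDICATE for speed) and the re-insertion of exclusion bits (`Entry.ok2_of_base`); §2 the PAIR
VALIDITY of an entry for a same-side pair of terminals with clamped level difference `τ ∈ [−7, 7]` (`pairOKB`: `|τ| = 7` far — the nearer leg
avoids the farther face; else tight — local separation both ways `locB` and vertex-distinctness `dvB`) with what it yields for `Entry.swap2`
(`LegAvoids`, `LocSep`, distinct vertices); §3 the BOUNDARY ACCEPTANCE of a leg for a boundary flag `β ∈ {0,1,2}` (`accB`).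
[cite: DuminilCopinSidoraviciusTassion2016, §2.3 (proof of Fact 2: the three disjoint paths γ_u, γ_v, γ_w in B_R(z))]
-/

namespace Summit.CriticalPhenomena.PercolationContinuityZ3.Theorems.Transplant

namespace Slab111

/-! ## §1 The bit-free part of `Entry.ok2` -/

/-- `LegFits2` as a Boolean, the region given by a predicate. [folklore] -/
def legFits2B (l : List MV) (q : ℤ × ℤ) (F : FaceD) (cB : ℤ × ℤ → Bool) (dir Λ : ℤ) : Bool :=
  legOKB l &&
    match l.getLast? with
    | none => false
    | some e =>
      faceMemB F (q + e.1) && decide (0 ≤ dir * e.2) && decide (dir * e.2 ≤ Λ) &&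
        l.all (fun p => p == e || !faceMemB F (q + p.1)) &&
        l.all (fun p => p == ((0, 0), 0) || (cB (q + p.1) && decide (-1 ≤ dir * p.2) && decide (dir * p.2 ≤ Λ)))

/-- Soundness of `legFits2B`. [folklore] -/
theorem legFits2_of_B {l : List MV} {q : ℤ × ℤ} {F : FaceD} {cB : ℤ × ℤ → Bool} {C : List (ℤ × ℤ)} (hC : ∀ c, cB c = true → c ∈ C)
    {dir Λ : ℤ} (h : legFits2B l q F cB dir Λ = true) : LegFits2 l q F C dir Λ := by
  unfold legFits2B at h
  rw [Bool.and_eq_true] at h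
  obtain ⟨hok, hrest⟩ := h
  have hl := legOK_of_B hok
  rw [List.getLast?_eq_some_getLast hl.1] at hrest
  simp only [Bool.and_eq_true, Bool.or_eq_true, decide_eq_true_eq, List.all_eq_true, Bool.not_eq_true', beq_iff_eq] at hrest
  obtain ⟨⟨⟨⟨hmem, h0⟩, hΛ⟩, hoff⟩, hreg⟩ := hrest
  refine ⟨hl, (faceMemB_iff F _).1 hmem, h0, hΛ, fun p hp hne => ?_, fun p hp hne => ?_⟩
  · rcases hoff p hp with e | e
    · exact absurd e hne
    · rw [← Bool.not_eq_true, faceMemB_iff] at e; exact e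
  · rcases hreg p hp with e | ⟨⟨hm, h1⟩, h2⟩
    · exact absurd e hne
    · exact ⟨hC _ hm, h1, h2⟩

/-- **The bit-free part of `Entry.ok2` as a Boolean** (regions by predicates `pcB`, `wcB`; the hub column must satisfy `pcB`). [folklore] -/
def Entry.baseB (e : Entry) (pcB wcB : ℤ × ℤ → Bool) (q₁ q₂ q₃ : ℤ × ℤ) (dir₁ dir₂ dir₃ Λ : ℤ) : Bool :=
  faceOkB e.F1 && faceOkB e.F2 && faceOkB e.F3 && offHubB e.F1 && offHubB e.F2 && offHubB e.F3 &&
  disjB e.F1 e.F2 && disjB e.F1 e.F3 && disjB e.F2 e.F3 && attB e.F1 e.d₁ && attB e.F2 e.d₂ && attB e.F3 e.d₃ &&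
  (pcB e.F1.f0 && pcB e.F1.f1 && pcB e.F1.f2) && (pcB e.F2.f0 && pcB e.F2.f1 && pcB e.F2.f2) &&
  (wcB e.F3.f0 && wcB e.F3.f1 && wcB e.F3.f2) && pcB (0, 0) &&
  legFits2B e.l₁ q₁ e.F1 pcB dir₁ Λ && legFits2B e.l₂ q₂ e.F2 pcB dir₂ Λ && legFits2B e.l₃ q₃ e.F3 wcB dir₃ Λ

/-- **Soundness of `Entry.baseB`**: `Entry.ok2` with all exclusion bits off. [folklore] -/
theorem Entry.ok2_of_baseB {e : Entry} {pcB wcB : ℤ × ℤ → Bool} {Pc Wc : List (ℤ × ℤ)} (hP : ∀ c, pcB c = true → c ∈ Pc)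
    (hW : ∀ c, wcB c = true → c ∈ Wc) {q₁ q₂ q₃ : ℤ × ℤ} {dir₁ dir₂ dir₃ Λ : ℤ} (h : e.baseB pcB wcB q₁ q₂ q₃ dir₁ dir₂ dir₃ Λ = true) :
    e.ok2 Pc Wc q₁ q₂ q₃ dir₁ dir₂ dir₃ Λ false false false false false false := by
  unfold Entry.baseB at h
  simp only [Bool.and_eq_true, and_assoc] at h
  obtain ⟨hF1, hF2, hF3, ho1, ho2, ho3, h12, h13, h23, hA1, hA2, hA3, p10, p11, p12, p20, p21, p22, w30, w31, w32, hhub, hl1, hl2, hl3⟩ := h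
  exact ⟨faceOk_of_B hF1, faceOk_of_B hF2, faceOk_of_B hF3, offHub_of_B ho1, offHub_of_B ho2, offHub_of_B ho3, disj_of_B h12, disj_of_B h13,
    disj_of_B h23, att_of_B hA1, att_of_B hA2, att_of_B hA3, ⟨hP _ p10, hP _ p11, hP _ p12⟩, ⟨hP _ p20, hP _ p21, hP _ p22⟩,
    ⟨hW _ w30, hW _ w31, hW _ w32⟩, hP _ hhub, legFits2_of_B hP hl1, legFits2_of_B hP hl2, legFits2_of_B hW hl3,
    by simp, by simp, by simp, by simp, by simp, by simp⟩

/-- **Re-inserting exclusion bits**: `Entry.ok2` with bits off plus the `LegAvoids` facts of the bits that are on. [folklore] -/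
theorem Entry.ok2_of_base {e : Entry} {Pc Wc : List (ℤ × ℤ)} {q₁ q₂ q₃ : ℤ × ℤ} {dir₁ dir₂ dir₃ Λ : ℤ}
    (h : e.ok2 Pc Wc q₁ q₂ q₃ dir₁ dir₂ dir₃ Λ false false false false false false) {x21 x31 x12 x32 x13 x23 : Bool}
    (a21 : x21 = true → LegAvoids e.l₁ q₁ e.F2) (a31 : x31 = true → LegAvoids e.l₁ q₁ e.F3) (a12 : x12 = true → LegAvoids e.l₂ q₂ e.F1)
    (a32 : x32 = true → LegAvoids e.l₂ q₂ e.F3) (a13 : x13 = true → LegAvoids e.l₃ q₃ e.F1) (a23 : x23 = true → LegAvoids e.l₃ q₃ e.F2) :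
    e.ok2 Pc Wc q₁ q₂ q₃ dir₁ dir₂ dir₃ Λ x21 x31 x12 x32 x13 x23 := by
  obtain ⟨hF1, hF2, hF3, ho1, ho2, ho3, h12, h13, h23, hA1, hA2, hA3, hF1P, hF2P, hF3W, hhub, hL1, hL2, hL3, -, -, -, -, -, -⟩ := h
  exact ⟨hF1, hF2, hF3, ho1, ho2, ho3, h12, h13, h23, hA1, hA2, hA3, hF1P, hF2P, hF3W, hhub, hL1, hL2, hL3, a21, a31, a12, a32, a13, a23⟩

/-! ## §2 Pair validity -/

/-- Local separation as a Boolean: every non-last vertex of `lI` over a column of `FJ` is strictly before `Δ + eJ` on the `d` side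
(`Δ = nJ − nI`, `eJ` = relative level of `J`'s leg end). [folklore] -/
def locB (lI : List MV) (qI : ℤ × ℤ) (FJ : FaceD) (eJ d Δ : ℤ) : Bool :=
  match lI.getLast? with
  | none => true
  | some e => lI.all fun p => p == e || !faceMemB FJ (qI + p.1) || ((d == 1) && decide (p.2 < Δ + eJ)) || ((d == -1) && decide (Δ + eJ < p.2))

/-- Vertex-distinctness of two legs at level difference `Δ = nJ − nI`, as a Boolean. [folklore] -/
def dvB (lI lJ : List MV) (qI qJ : ℤ × ℤ) (Δ : ℤ) : Bool :=
  lI.all fun p => lJ.all fun p' => !((qI + p.1 == qJ + p'.1) && (p.2 == Δ + p'.2))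

/-- **PAIR VALIDITY** of legs `lI, lJ` (terminal columns `qI, qJ`, faces `FI, FJ`, common direction `d`) for the clamped level difference
`τ = clamp(nJ − nI) ∈ [−7, 7]`: far (`|τ| = 7`) — the leg of the terminal nearer the zone avoids the columns of the other's face; tight —
local separation both ways and vertex-distinctness at `Δ = τ`. [folklore] -/
def pairOKB (lI lJ : List MV) (qI qJ : ℤ × ℤ) (FI FJ : FaceD) (d τ : ℤ) : Bool :=
  if τ = 7 ∨ τ = -7 then
    (if (d = 1 ∧ τ = 7) ∨ (d = -1 ∧ τ = -7) then legAvoidsB lJ qJ FI else legAvoidsB lI qI FJ)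
  else locB lI qI FJ (lastOff lJ) d τ && locB lJ qJ FI (lastOff lI) d (-τ) && dvB lI lJ qI qJ τ

/-- Soundness of `locB`: `LocSep` at levels with `nJ = nI + Δ`. [folklore] -/
theorem locSep_of_B {lI lJ : List MV} {qI : ℤ × ℤ} {FJ : FaceD} {d Δ nI nJ : ℤ} (h : locB lI qI FJ (lastOff lJ) d Δ = true) (hn : nJ = nI + Δ) :
    LocSep lI lJ qI FJ d nI nJ := by
  intro p hp hpl
  unfold locB at h
  cases hl : lI.getLast? with
  | none => rw [List.getLast?_eq_none_iff] at hl; rw [hl] at hp; simp at hp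
  | some e =>
    rw [hl] at h hpl
    simp only [List.all_eq_true, Bool.or_eq_true, beq_iff_eq, Bool.not_eq_true', Bool.and_eq_true, decide_eq_true_eq] at h
    rcases h p hp with ((heq | hm) | ⟨hd, hlt⟩) | ⟨hd, hlt⟩
    · exact absurd (congrArg some heq.symm) hpl
    · left; rw [← Bool.not_eq_true, faceMemB_iff] at hm; exact hm
    · right; left; exact ⟨hd, by omega⟩
    · right; right; exact ⟨hd, by omega⟩

/-- Soundness of `dvB`: the legs share no vertex when `nJ = nI + Δ`. [folklore] -/
theorem dv_of_B {lI lJ : List MV} {qI qJ : ℤ × ℤ} {Δ nI nJ : ℤ} (h : dvB lI lJ qI qJ Δ = true) (hn : nJ = nI + Δ) :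
    ∀ p ∈ lI, ∀ p' ∈ lJ, (qI + p.1, nI + p.2) ≠ (qJ + p'.1, nJ + p'.2) := by
  intro p hp p' hp' heq
  unfold dvB at h
  rw [List.all_eq_true] at h
  have h1 := h p hp
  rw [List.all_eq_true] at h1
  have h2 := h1 p' hp'
  simp only [Bool.not_eq_true', Bool.and_eq_false_iff, beq_eq_false_iff_ne, ne_eq] at h2
  simp only [Prod.mk.injEq] at heq
  rcases h2 with h2 | h2
  · exact h2 heq.1
  · apply h2; omega

/-- What pair validity yields in the FAR case with `J` nearer the zone. [folklore] -/
theorem pairOKB_farJ {lI lJ : List MV} {qI qJ : ℤ × ℤ} {FI FJ : FaceD} {d τ : ℤ} (h : pairOKB lI lJ qI qJ FI FJ d τ = true)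
    (hτ : τ = 7 ∨ τ = -7) (hJ : (d = 1 ∧ τ = 7) ∨ (d = -1 ∧ τ = -7)) : LegAvoids lJ qJ FI := by
  unfold pairOKB at h; rw [if_pos hτ, if_pos hJ] at h; exact legAvoids_of_B h

/-- What pair validity yields in the FAR case with `I` nearer the zone. [folklore] -/
theorem pairOKB_farI {lI lJ : List MV} {qI qJ : ℤ × ℤ} {FI FJ : FaceD} {d τ : ℤ} (h : pairOKB lI lJ qI qJ FI FJ d τ = true)
    (hτ : τ = 7 ∨ τ = -7) (hI : ¬ ((d = 1 ∧ τ = 7) ∨ (d = -1 ∧ τ = -7))) : LegAvoids lI qI FJ := by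
  unfold pairOKB at h; rw [if_pos hτ, if_neg hI] at h; exact legAvoids_of_B h

/-- What pair validity yields in the TIGHT case (`nJ = nI + τ`): local separation both ways and distinct vertices. [folklore] -/
theorem pairOKB_tight {lI lJ : List MV} {qI qJ : ℤ × ℤ} {FI FJ : FaceD} {d τ : ℤ} (h : pairOKB lI lJ qI qJ FI FJ d τ = true)
    (hτ : ¬ (τ = 7 ∨ τ = -7)) {nI nJ : ℤ} (hn : nJ = nI + τ) :
    LocSep lI lJ qI FJ d nI nJ ∧ LocSep lJ lI qJ FI d nJ nI ∧ ∀ p ∈ lI, ∀ p' ∈ lJ, (qI + p.1, nI + p.2) ≠ (qJ + p'.1, nJ + p'.2) := by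
  unfold pairOKB at h; rw [if_neg hτ] at h
  simp only [Bool.and_eq_true] at h
  obtain ⟨⟨h1, h2⟩, h3⟩ := h
  exact ⟨locSep_of_B h1 hn, locSep_of_B h2 (by omega), dv_of_B h3 hn⟩

/-! ## §3 Boundary acceptance -/

/-- **Boundary acceptance** of a leg (terminal column `q`, direction `d`) for the boundary flag `β` (`0`: the terminal is ON the boundary
behind it, `1`: next to it, `2`: at distance `≥ 2`): every non-terminal LOW vertex (`d·Δℓ = o ∈ {−1, 0}`) sits at boundary distance `β + o ≥ 0`,
and if that is `0` its column is not a bad corner (`badB`: the columns missing from `W` on that boundary level). [folklore] -/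
def accB (l : List MV) (q : ℤ × ℤ) (d : ℤ) (β : ℕ) (badB : ℤ × ℤ → Bool) : Bool :=
  l.all fun p => p == ((0, 0), 0) || decide (1 ≤ d * p.2) ||
    (decide (β = 2) || (decide (0 ≤ (β : ℤ) + d * p.2) && (!decide ((β : ℤ) + d * p.2 = 0) || !badB (q + p.1))))

/-- What boundary acceptance yields for a low vertex. [folklore] -/
theorem accB_low {l : List MV} {q : ℤ × ℤ} {d : ℤ} {β : ℕ} {badB : ℤ × ℤ → Bool} (h : accB l q d β badB = true) {p : MV} (hp : p ∈ l)
    (hp0 : p ≠ ((0, 0), 0)) (hlow : d * p.2 ≤ 0) : β = 2 ∨ (0 ≤ (β : ℤ) + d * p.2 ∧ ((β : ℤ) + d * p.2 = 0 → badB (q + p.1) = false)) := by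
  unfold accB at h
  rw [List.all_eq_true] at h
  have h' := h p hp
  simp only [Bool.or_eq_true, beq_iff_eq, decide_eq_true_eq, Bool.and_eq_true, Bool.not_eq_true', decide_eq_false_iff_not, or_assoc] at h'
  rcases h' with e | e | e | ⟨h0, hc⟩
  · exact absurd e hp0
  · omega
  · exact Or.inl e
  · right; refine ⟨h0, fun hz => ?_⟩
    rcases hc with hc | hc
    · exact absurd hz hc
    · exact hc

end Slab111

end Summit.CriticalPhenomena.PercolationContinuityZ3.Theorems.Transplant
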